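import Summits.QuantumFields.YangMills.Theorems.FluctuationComparisonRegPrIntLOrganTangentOneBondLaw
import Summits.QuantumFields.YangMills.Theorems.FluctuationComparisonRegPrIntLOrganTangentAPackageAtDescend
import Literature.MathematicalPhysics.QuantumFieldTheory.Balaban1983to89.T3ThresholdSmallness
import HarnessLib

/-!
# `FluctuationComparisonRegPrIntLOrganTangentAPackageFromHeight` — (L8) THE (A)-PACKAGE AT `descend` HOLDS UNCONDITIONALLY FROM A HEIGHT:
# the residual per-bond letters (M1)(M2) of ✓`…OrganTangentAPackageAtDescend.exists_height_regularSmallFieldDisintegration_of_oneBondLaws` (w4 g21) are DISCHARGED by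
# ✓(L7) `…OrganTangentOneBondLaw.oneBondLaw` once the window `24∕25·θ_{j+1}` is below an explicit geometric threshold, which `θ_j → 0` (✓`T3ThresholdSmallness.tendsto_θBal_atTop`) grants

Cell `ym3-torus` (rung R3 = continuum `SU(2)` Yang–Mills on T³ — NOT d = 4, NOT infinite volume, NOT a mass gap, NOT Clay), width seat `ym-ust-20520-w5` (gen 21), pen (L8).
`--kind proof --supports stmt-QuantumFields-20520 --as helper`, count-neutral, definition-free, default heartbeats; THEOREMS ONLY; nothing printed is asserted.

§1 index geometry of the (0.4) average on the T³ tori (`d = 3`, `L ≥ 3` odd): the corner offset index is off-central at EVERY bond (`not_isCentral_corner`), the centre index is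
central (`isCentral_centre`), so `offCard ĉ ≤ |Idx| − 1` (`offCard_div_card_le`).  §2 ★★★★ `exists_height_regularSmallFieldDisintegration`: for EVERY `F : T3Family` and every
`0 < γ ≤ 1`, `0 < b₀`, `0 < p₀` THERE IS a height `jA` such that for all `j ≥ jA` the (A)-PACKAGE at `descend F ℰp j` with window constant `24∕25` holds — the `∃ σ₀ lam, …` text of
w4's theorem VERBATIM, with NO residual letter: the constants `(s, ρ, d₀, ρ″)` are explicit in `(δ₂, L, |Idx|)` and the height is where `6L²·(24∕25)·θ_{j+1}` drops below them.
NOT HERE: VER∘ ∕ COAREA∘ ∕ LIN∘ ∕ JEN∘ ∕ O1 ∕ crux 20520 ∕ `YM3TorusSU2` (the (A)-package is ONE input of LEAD's KNITc); nothing of Bałaban's estimates asserted.  No `def`, `instance`, `sorry`.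
-/

set_option autoImplicit false

noncomputable section

namespace Summit.QuantumFields.YangMills.Theorems.FluctuationComparisonRegPrIntLOrganTangentAPackageFromHeight

open Set Function Filter Topology MeasureTheory
open scoped ENNReal NNReal
open Literature.MathematicalPhysics.QuantumFieldTheory.Balaban1983to89
open Literature.MathematicalPhysics.QuantumFieldTheory.Balaban1983to89.T3OrbitAverage
open T3ContinuumYM3Torus T3NestedUnitLaws T3UnitLawDensityEML T3UnitScaleTilt T3LevelShift T4Continuum AveragingRT BlockAveraging
open Literature.MathematicalPhysics.QuantumFieldTheory.Balaban1983to89.BlockAveragingHaarAC (centralBond IsCentral)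
open Literature.MathematicalPhysics.QuantumFieldTheory.Balaban1983to89.BlockAveragingEMLHaarAC (offCard)
open ExpMeanLog (deltaSU deltaSU_pos)
open Summit.QuantumFields.YangMills.Theorems.FluctuationComparisonRegPrIntLOrganTangentOneBondLaw (oneBondLaw)
open Summit.QuantumFields.YangMills.Theorems.OrganTangentAPackageAtDescend (exists_height_regularSmallFieldDisintegration_of_oneBondLaws)

/-! ## §1 Index geometry on the T³ tori -/

/-- The range facts of a `T3Family` torus at every height: `d = 3`, `L = F.L ≥ 3`. [cite: Balaban1985Averaging, (17) p.21] -/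
theorem torus_d_L (F : T3Family) (K : ℕ) : (F.P K).d = 3 ∧ (F.P K).L = F.L ∧ 3 ≤ F.L := by
  refine ⟨rfl, rfl, ?_⟩
  obtain ⟨⟨k, hk⟩, h1⟩ := F.hL
  omega

/-- **THE CORNER INDEX IS OFF-CENTRAL AT EVERY BOND**: the offset vector `r ≡ 0` has all coordinates `−(L−1)∕2 ≠ 0` off the centre, and `d = 3 ≥ 2` leaves a direction
transverse to any bond. [cite: Balaban1985Averaging, (19)-(20) p.21 (bookkeeping)] -/
theorem not_isCentral_corner (F : T3Family) (K k : ℕ) (b : PBond (F.P K) (k + 1)) :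
    ¬ IsCentral b ((fun _ => ⟨0, by have := (torus_d_L F K).2.2; rw [(torus_d_L F K).2.1]; omega⟩), 1, 1) := by
  intro h
  have hL3 : 3 ≤ (F.P K).L := by rw [(torus_d_L F K).2.1]; exact (torus_d_L F K).2.2
  -- a direction transverse to `b`
  obtain ⟨ν, hν⟩ : ∃ ν : Fin (F.P K).d, ν ≠ b.dir := by
    by_cases h0 : b.dir = ⟨0, by rw [(torus_d_L F K).1]; omega⟩
    · exact ⟨⟨1, by rw [(torus_d_L F K).1]; omega⟩, by rw [h0]; exact fun h => by simp at h⟩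
    · exact ⟨⟨0, by rw [(torus_d_L F K).1]; omega⟩, fun h => h0 h.symm⟩
  have hoff := h ν hν
  simp only [off, CharP.cast_eq_zero, zero_sub, neg_eq_zero, Nat.cast_eq_zero] at hoff
  omega

/-- **THE CENTRE INDEX IS CENTRAL** (offset vector `≡ (L−1)∕2`). [cite: Balaban1985Averaging, (19)-(20) p.21 (bookkeeping)] -/
theorem isCentral_centre (F : T3Family) (K k : ℕ) (b : PBond (F.P K) (k + 1)) :
    IsCentral b ((fun _ => ⟨((F.P K).L - 1) / 2, by
      have h3 := (torus_d_L F K).2.2; have hL : (F.P K).L = F.L := (torus_d_L F K).2.1; omega⟩), 1, 1) := by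
  intro ν _
  simp only [off, sub_self]

/-- **THE OFF-CENTRAL FRACTION IS AT MOST `1 − 1∕|Idx|`** at every bond. [cite: Balaban1985Averaging, (19)-(20) p.21 (bookkeeping)] -/
theorem offCard_div_card_le (F : T3Family) (K k : ℕ) (b : PBond (F.P K) (k + 1)) :
    (offCard b : ℝ) / (Fintype.card (Idx (F.P K)) : ℝ) ≤ 1 - ((Fintype.card (Idx (F.P K)) : ℝ))⁻¹ := by
  have hlt : offCard b < Fintype.card (Idx (F.P K)) :=
    Fintype.card_subtype_lt (p := fun i => ¬ IsCentral b i) (x := _) (not_not_intro (isCentral_centre F K k b))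
  have hcard : (0 : ℝ) < Fintype.card (Idx (F.P K)) := by exact_mod_cast Fintype.card_pos
  have hle : (offCard b : ℝ) ≤ (Fintype.card (Idx (F.P K)) : ℝ) - 1 := by
    have : offCard b + 1 ≤ Fintype.card (Idx (F.P K)) := hlt
    have h' : ((offCard b : ℕ) : ℝ) + 1 ≤ (Fintype.card (Idx (F.P K)) : ℝ) := by exact_mod_cast this
    linarith
  rw [div_le_iff₀ hcard, sub_mul, one_mul, inv_mul_cancel₀ hcard.ne']
  exact hle

/-- The filter form of the same count (`offCard` is the subtype cardinality). [folklore] -/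
theorem filterCard_eq_offCard {P : Params} {k : ℕ} (b : PBond P (k + 1)) :
    (Finset.univ.filter fun i : Idx P => ¬ IsCentral b i).card = offCard b := (Fintype.card_subtype _).symm

/-! ## §2 The (A)-package from a height, no residual letter -/

/-- ★★★★ **THE (A)-PACKAGE AT `descend` FROM A HEIGHT, UNCONDITIONALLY** (see the module docstring): the composition of w4 g21's
✓`exists_height_regularSmallFieldDisintegration_of_oneBondLaws` (TRIc ∘ DescendSection ∘ MASSc ∘ (β′), σ₀ constructed) with ✓(L7) `oneBondLaw` (Stage 1 ⊕ pub-ymgap's forward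
Jacobian law), at explicit constants and a height where `θ_{j+1}` is small (✓`tendsto_θBal_atTop`).
[cite: Balaban1987RG1, (0.4) p.253, (0.18) p.255, (2.4) p.266, (2.10) p.267; Balaban1985Averaging, (10)-(13) p.19; Helgason2000, Ch. I §1 Thm. 1.14 (13) p.96] -/
theorem exists_height_regularSmallFieldDisintegration
    (F : T3Family) (γ b₀ p₀ : ℝ) (hγ : 0 < γ) (hγ1 : γ ≤ 1) (hb₀ : 0 < b₀) (hp₀ : 0 < p₀) :
    ∃ jA : ℕ, ∀ (j : ℕ), jA ≤ j →
      ∃ (σ₀ : ProbabilityTheory.Kernel (GaugeField (F.P j) 0 ↥(Matrix.specialUnitaryGroup (Fin 2) ℂ))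
          (GaugeField (F.P (j + 1)) 0 ↥(Matrix.specialUnitaryGroup (Fin 2) ℂ)))
        (lam : GaugeField (F.P j) 0 ↥(Matrix.specialUnitaryGroup (Fin 2) ℂ) →
          Measure (GaugeField (F.P (j + 1)) 0 ↥(Matrix.specialUnitaryGroup (Fin 2) ℂ))),
        ProbabilityTheory.IsMarkovKernel σ₀ ∧
        (Measure.map (descend F ℰp j) (fieldMeasure (F.P (j + 1)) 0 ↥(Matrix.specialUnitaryGroup (Fin 2) ℂ))).bind ⇑σ₀ =
          fieldMeasure (F.P (j + 1)) 0 ↥(Matrix.specialUnitaryGroup (Fin 2) ℂ) ∧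
        (∀ᵐ V ∂(Measure.map (descend F ℰp j) (fieldMeasure (F.P (j + 1)) 0 ↥(Matrix.specialUnitaryGroup (Fin 2) ℂ))),
          ∀ᵐ U ∂(σ₀ V), descend F ℰp j U = V) ∧
        (∀ V, IsFiniteMeasure (lam V)) ∧
        (∀ f : GaugeField (F.P (j + 1)) 0 ↥(Matrix.specialUnitaryGroup (Fin 2) ℂ) → ℝ, Continuous f →
          (∀ U, f U ≠ 0 → PlaqSmall (24 / 25 * θBal F.L γ b₀ p₀ (j + 1)) U) →
          ContinuousOn (fun V => ∫ U, f U ∂(lam V)) {V | PlaqSmall (θBal F.L γ b₀ p₀ j) V}) ∧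
        (∀ V, PlaqSmall (θBal F.L γ b₀ p₀ j) V → 0 < lam V {U | PlaqSmall (24 / 25 * θBal F.L γ b₀ p₀ (j + 1)) U}) ∧
        (∃ c : GaugeField (F.P j) 0 ↥(Matrix.specialUnitaryGroup (Fin 2) ℂ) → ℝ,
          ∀ f : GaugeField (F.P (j + 1)) 0 ↥(Matrix.specialUnitaryGroup (Fin 2) ℂ) → ℝ, Continuous f →
            (∀ U, ¬ PlaqSmall (24 / 25 * θBal F.L γ b₀ p₀ (j + 1)) U → f U = 0) →
            ∀ᵐ V ∂(Measure.map (descend F ℰp j) (fieldMeasure (F.P (j + 1)) 0 ↥(Matrix.specialUnitaryGroup (Fin 2) ℂ))),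
              PlaqSmall (θBal F.L γ b₀ p₀ j) V → 0 < c V ∧ ∫ U, f U ∂(σ₀ V) = c V * ∫ U, f U ∂(lam V))  := by
  classical
  obtain ⟨jV, hV⟩ := exists_height_regularSmallFieldDisintegration_of_oneBondLaws F γ b₀ p₀ hγ hγ1 hb₀ hp₀
  -- the constants (the index count `N` is the same number `36·L³` at every height; we only use that it is a positive constant type-wise at height 1 … so we
  -- phrase everything through `ε j := (Fintype.card (Idx (F.P (j+1))))⁻¹`, which is DEFINITIONALLY independent of `j`)
  have hL3 : (3 : ℝ) ≤ F.L := by exact_mod_cast (torus_d_L F 0).2.2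
  have hL0 : (0 : ℝ) < F.L := by linarith
  set δ : ℝ := deltaSU (Fin 2) with hδ
  have hδ0 : 0 < δ := deltaSU_pos
  -- `|Idx|` does not depend on the height (the torus parameters `d = 3`, `L = F.L` are the same at every height)
  have hcard : ∀ j : ℕ, (Fintype.card (Idx (F.P (j + 1))) : ℝ) = (Fintype.card (Idx (F.P 1)) : ℝ) := fun j => rfl
  set ε : ℝ := ((Fintype.card (Idx (F.P 1)) : ℝ))⁻¹ with hε
  have hN0 : (0 : ℝ) < Fintype.card (Idx (F.P 1)) := by exact_mod_cast Fintype.card_pos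
  have hε0 : 0 < ε := inv_pos.2 hN0
  have hε1 : ε ≤ 1 := inv_le_one_of_one_le₀ (by exact_mod_cast Fintype.card_pos)
  -- the radii
  set α₀ : ℝ := min (min (1 / 48) (δ / 64)) (min (1 / (314 * (F.L : ℝ) ^ 2)) (ε / 300)) with hα₀
  have hα₀pos : 0 < α₀ := by
    simp only [hα₀, lt_min_iff]; refine ⟨⟨by norm_num, by positivity⟩, by positivity, by positivity⟩
  have hα₁ : α₀ ≤ 1 / 48 := (min_le_left _ _).trans (min_le_left _ _)
  have hα₂ : α₀ ≤ δ / 64 := (min_le_left _ _).trans (min_le_right _ _)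
  have hα₃ : α₀ ≤ 1 / (314 * (F.L : ℝ) ^ 2) := (min_le_right _ _).trans (min_le_left _ _)
  have hα₄ : α₀ ≤ ε / 300 := (min_le_right _ _).trans (min_le_right _ _)
  set ρ : ℝ := α₀ * ε / 4 with hρ
  set s : ℝ := ε * ρ / 8 with hs
  set d₀ : ℝ := α₀ - ρ - s with hd₀
  set ρ'' : ℝ := ε * ρ / 4 with hρ''
  have hρpos : 0 < ρ := by positivity
  have hspos : 0 < s := by positivity
  have hρα : ρ ≤ α₀ / 4 := by
    have h := mul_le_mul_of_nonneg_left hε1 hα₀pos.le; rw [hρ]; linarith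
  have hsρ : s ≤ ρ / 8 := by
    have h := mul_le_mul_of_nonneg_right hε1 hρpos.le; rw [hs]; linarith
  have hd₀pos : 0 < d₀ := by rw [hd₀]; linarith
  have hsum : s + ρ + d₀ = α₀ := by rw [hd₀]; ring
  have hρ''pos : 0 < ρ'' := by positivity
  -- the threshold for `θ_{j+1}` and the height
  set τ : ℝ := min (min δ (s / 2)) (min (ρ'' / 14) ρ) / (6 * (F.L : ℝ) ^ 2 + 1) with hτ
  have hτpos : 0 < τ := by positivity
  have hθ := (T3ThresholdSmallness.tendsto_θBal_atTop F.hL.2 hγ b₀ p₀).eventually (gt_mem_nhds hτpos)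
  obtain ⟨j₁, hj₁⟩ := eventually_atTop.1 hθ
  refine ⟨max jV j₁, fun j hj => ?_⟩
  have hjV : jV ≤ j := le_of_max_le_left hj
  have hθj : θBal F.L γ b₀ p₀ (j + 1) < τ := hj₁ (j + 1) (by have := le_of_max_le_right hj; omega)
  have hθpos : 0 < θBal F.L γ b₀ p₀ (j + 1) := T3MinimiserStabilityReduction.θBal_pos (by have := F.hL.2; omega) hγ hγ1 hb₀ p₀ (j + 1)
  -- the smallness `t = 6L²·(24∕25)·θ_{j+1}`
  have ht_eq : (((((F.P (j + 1)).d + 2) * (F.P (j + 1)).L : ℕ) : ℝ) ^ 2 / 4) * (24 / 25 * θBal F.L γ b₀ p₀ (j + 1)) =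
      6 * (F.L : ℝ) ^ 2 * θBal F.L γ b₀ p₀ (j + 1) := by
    have : ((F.P (j + 1)).d + 2) * (F.P (j + 1)).L = 5 * F.L := rfl
    rw [this]; push_cast; ring
  have htlt : 6 * (F.L : ℝ) ^ 2 * θBal F.L γ b₀ p₀ (j + 1) < min (min δ (s / 2)) (min (ρ'' / 14) ρ) := by
    have h1 : 6 * (F.L : ℝ) ^ 2 * θBal F.L γ b₀ p₀ (j + 1) < (6 * (F.L : ℝ) ^ 2 + 1) * τ := by
      have h := mul_lt_mul_of_pos_left hθj (show (0 : ℝ) < 6 * (F.L : ℝ) ^ 2 by positivity)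
      have h' : (6 * (F.L : ℝ) ^ 2 + 1) * τ = 6 * (F.L : ℝ) ^ 2 * τ + τ := by ring
      rw [h']; linarith
    have h2 : (6 * (F.L : ℝ) ^ 2 + 1) * τ = min (min δ (s / 2)) (min (ρ'' / 14) ρ) := by
      rw [hτ, mul_div_cancel₀ _ (by positivity)]
    linarith
  have htδ : 6 * (F.L : ℝ) ^ 2 * θBal F.L γ b₀ p₀ (j + 1) < δ := htlt.trans_le ((min_le_left _ _).trans (min_le_left _ _))
  have hts : 6 * (F.L : ℝ) ^ 2 * θBal F.L γ b₀ p₀ (j + 1) < s / 2 := htlt.trans_le ((min_le_left _ _).trans (min_le_right _ _))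
  have htρ'' : 6 * (F.L : ℝ) ^ 2 * θBal F.L γ b₀ p₀ (j + 1) < ρ'' / 14 := htlt.trans_le ((min_le_right _ _).trans (min_le_left _ _))
  have htρ : 6 * (F.L : ℝ) ^ 2 * θBal F.L γ b₀ p₀ (j + 1) < ρ := htlt.trans_le ((min_le_right _ _).trans (min_le_right _ _))
  -- the off-central fractions
  have hμ : ∀ c : PBond (F.P j) 0, (offCard (bondShift (sitesPerDir_descend F j 0) c) : ℝ) / (Fintype.card (Idx (F.P (j + 1))) : ℝ) ≤ 1 - ε :=
    fun c => by rw [hε, ← hcard j]; exact offCard_div_card_le F (j + 1) 0 _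
  -- Stage 2 at these constants
  obtain ⟨Ω, T, T', θ, jac, M, hΩm, hTm, hθm, hjm, hΩbl, hright, hlaw, hTo, hT'T, hmargin, hΩS, hθc, hjc, hjM, hToj, hθcj, hsol, hjpos⟩ :=
    oneBondLaw F j _ (fun c => not_isCentral_corner F (j + 1) 0 (bondShift (sitesPerDir_descend F j 0) c))
      (s := s) (ρ := ρ) (d₀ := d₀) (ρ'' := ρ'') (a := 24 / 25 * θBal F.L γ b₀ p₀ (j + 1))
      hspos hρpos.le hd₀pos (by rw [hsum]; linarith) (by rw [hsum]; linarith)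
      (fun c => by rw [filterCard_eq_offCard, hsum]; linarith [hμ c])
      hρ''pos
      (fun c => by
        rw [filterCard_eq_offCard]
        have hμc := hμ c
        have hsr0 : 0 ≤ s + ρ := by positivity
        -- μ(s+ρ) ≤ (s+ρ) − ερ
        have h1 : (offCard (bondShift (sitesPerDir_descend F j 0) c) : ℝ) / (Fintype.card (Idx (F.P (j + 1))) : ℝ) * (s + ρ) ≤ s + ρ - ε * ρ := by
          have h := mul_le_mul_of_nonneg_right hμc hsr0
          have h' : (1 - ε) * (s + ρ) = s + ρ - ε * s - ε * ρ := by ring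
          rw [h'] at h; linarith [mul_nonneg hε0.le hspos.le]
        -- (s+ρ)² ≤ (81/64) ρ²
        have h2 : (s + ρ) ^ 2 ≤ 81 / 64 * ρ ^ 2 := by
          have hle : s + ρ ≤ 9 / 8 * ρ := by linarith
          have h := mul_le_mul hle hle hsr0 (by positivity)
          have h' : 9 / 8 * ρ * (9 / 8 * ρ) = 81 / 64 * ρ ^ 2 := by ring
          rw [← pow_two, h'] at h; exact h
        -- ρ² ≤ ερ/192
        have hρε : ρ ≤ ε / 192 := by
          have h := mul_le_mul_of_nonneg_right hα₁ hε0.le; rw [hρ]; linarith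
        have h3 : ρ ^ 2 ≤ ε * ρ / 192 := by
          have h := mul_le_mul_of_nonneg_left hρε hρpos.le
          have h' : ρ * (ε / 192) = ε * ρ / 192 := by ring
          rw [pow_two, ← h']; exact h
        have h4 : 0 < ε * ρ := mul_pos hε0 hρpos
        rw [hρ'']; rw [hs] at h1 h2 ⊢; linarith)
      (mul_pos (by norm_num) hθpos).le (by rw [ht_eq]; exact htδ) (by rw [ht_eq]; linarith) (by rw [ht_eq]; exact htρ.le) (by rw [ht_eq]; linarith)
      (by rw [hsum]; linarith)
      (by
        rw [hsum, (torus_d_L F (j + 1)).1]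
        show 157 * α₀ < ((F.L : ℝ) ^ (3 - 1))⁻¹
        have hL2 : (0 : ℝ) < (F.L : ℝ) ^ 2 := by positivity
        have key : α₀ * (314 * (F.L : ℝ) ^ 2) ≤ 1 := (le_div_iff₀ (by positivity)).1 hα₃
        have h1 : 157 * α₀ * (F.L : ℝ) ^ 2 < 1 := by
          have h' : 157 * α₀ * (F.L : ℝ) ^ 2 = α₀ * (314 * (F.L : ℝ) ^ 2) / 2 := by ring
          rw [h']; linarith
        rw [show (3 : ℕ) - 1 = 2 from rfl, inv_eq_one_div, lt_div_iff₀ hL2]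
        exact h1)
      (fun c => by rw [hsum]; linarith [hμ c])
  refine hV j hjV Ω T θ jac hΩm hTm hθm hjm hΩbl hright hlaw T' hT'T (fun U V _ hVT hsm => hmargin U V hVT hsm) hΩS hjc M hjM hToj hθcj
    (fun c U v hv => pos_iff_ne_zero.2 (hjpos c U v hv)) fun U hU c => ⟨subset_closure.trans (hT'T c U) (hsol U hU c).1, (hsol U hU c).2⟩

end Summit.QuantumFields.YangMills.Theorems.FluctuationComparisonRegPrIntLOrganTangentAPackageFromHeight

end
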